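import Summits.HubbardSuperconductivity.HubbardSuperconductivity.Theorems.BalabanIRBirComplexStableXYRStubSubGaussianMargin
import Summits.HubbardSuperconductivity.HubbardSuperconductivity.Theorems.BalabanIRBirComplexStableXYRHessianOrigin
import HarnessLib

/-!
# Crux `BirComplexStableXYR`, line `fat-gaussian-defect-calculus`: stub S7 `stub_largeFieldRegulated`

Helper (`--supports`) for the crux
`Summit.HubbardSuperconductivity.HubbardSuperconductivity.Theses.BalabanIR.BirComplexStableXYR`
(item `stmt-HubbardSuperconductivity-14845`), line `fat-gaussian-defect-calculus` (lead skeleton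
`Cruxes/BirComplexStableXYR/Lines/fat_gaussian_defect_calculus.lean`), registered stub S7
`stub_largeFieldRegulated` — the scale-0 large-field factor in the regulated sup-norm.

**Statement.** For a window table `c : Table r` with (U1) zero-sum frequencies, (N) `Σ c_n = 0`,
(A) `normA c ≤ B` and the coercivity (C) `c₀ ΣΣ(1 − cos(φ_w − φ_w')) ≤ Re F(φ)` (`F = genF c`, `c₀ > 0`,
`B > 0`, `K ≥ 0`), write `Q(φ) := Re(−Σ_n c_n (n·φ)²)` (twice the real window Hessian at the constants)
and `ε₀ := 2c₀r³/(π²B)`.  On a window of oscillation between `p ≥ 0` and `π`,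

  `‖e^{−K F(φ)}‖ ≤ e^{−(K/2)Q(φ)} · e^{(1−ε₀)(K/2)Q(φ)} · e^{−ε₀ c₀ K p²}`.

**Proof.** The landed S3 `FatGaussian.stub_subGaussianMargin` gives `‖e^{−KF(φ)}‖ ≤ e^{−ε₀ K Q(φ)}`; the
landed window Hessian coercivity `Theorems.cvxr_re_hess_origin_ge` gives
`c₀ ΣΣ(φ_w − φ_w')² ≤ Q(φ)`, and the double sum over ordered pairs contains the two terms `(w,w')`,
`(w',w)` of the witness pair, each `≥ p²`, so `2c₀p² ≤ Q(φ)`.  Finally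
`−ε₀KQ = −(K/2)Q + (1−ε₀)(K/2)Q − (ε₀/2)KQ ≤ −(K/2)Q + (1−ε₀)(K/2)Q − ε₀c₀Kp²`. [folklore]

No definitions; sorry-free; everything else is Mathlib.
-/

set_option linter.dupNamespace false -- summit = problem name (single-conjunct summit), D-0017

noncomputable section

namespace Summit.HubbardSuperconductivity.HubbardSuperconductivity.Theorems.FatGaussian

open scoped BigOperators ComplexConjugate
open MeasureTheory Literature.Probability.LatticeModels Summit.HubbardSuperconductivity.BirComplexStableXYNegative

/-- If some ordered pair of window sites has `p ≤ |φ_w − φ_w'|` (`p ≥ 0`), then the complete-window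
Dirichlet form dominates `2p²`: `2 p² ≤ Σ_u Σ_u' (φ_u − φ_u')²` (the two ordered pairs `(w,w')`, `(w',w)`;
if `w = w'` then `p = 0`). [folklore] -/
theorem two_mul_sq_le_sum_sum_sub_sq {r : ℕ} {p : ℝ} (hp : 0 ≤ p) (φ : W r → ℝ) {w w' : W r}
    (hww : p ≤ |φ w - φ w'|) : 2 * p ^ 2 ≤ ∑ u, ∑ u', (φ u - φ u') ^ 2 := by
  have hpw : p ^ 2 ≤ (φ w - φ w') ^ 2 := by
    rw [← sq_abs (φ w - φ w')]
    exact pow_le_pow_left₀ hp hww 2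
  have hf0 : ∀ u : W r, 0 ≤ ∑ u', (φ u - φ u') ^ 2 := fun u =>
    Finset.sum_nonneg fun u' _ => sq_nonneg _
  by_cases hne : w = w'
  · have h0 : (φ w - φ w') ^ 2 = 0 := by rw [hne, sub_self]; ring
    have hS : 0 ≤ ∑ u, ∑ u', (φ u - φ u') ^ 2 := Finset.sum_nonneg fun u _ => hf0 u
    linarith
  · have hfw : p ^ 2 ≤ ∑ u', (φ w - φ u') ^ 2 :=
      hpw.trans (Finset.single_le_sum (f := fun u' => (φ w - φ u') ^ 2)
        (fun u' _ => sq_nonneg _) (Finset.mem_univ w'))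
    have hfw' : p ^ 2 ≤ ∑ u', (φ w' - φ u') ^ 2 := by
      have h' : p ^ 2 ≤ (φ w' - φ w) ^ 2 :=
        calc p ^ 2 ≤ (φ w - φ w') ^ 2 := hpw
          _ = (φ w' - φ w) ^ 2 := by ring
      exact h'.trans (Finset.single_le_sum (f := fun u' => (φ w' - φ u') ^ 2)
        (fun u' _ => sq_nonneg _) (Finset.mem_univ w))
    have hpair : ∑ u', (φ w - φ u') ^ 2 + ∑ u', (φ w' - φ u') ^ 2 ≤
        ∑ u, ∑ u', (φ u - φ u') ^ 2 := by
      rw [← Finset.sum_pair (f := fun u => ∑ u', (φ u - φ u') ^ 2) hne]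
      exact Finset.sum_le_univ_sum_of_nonneg hf0
    linarith

/-- **Stub S7 `stub_largeFieldRegulated` (registered signature, verbatim): the scale-0 large-field
factor in the regulated sup-norm.**  On a window of oscillation between `p` and `π`, with
`ε₀ := 2c₀r³/(π²B)` and `Q(φ) := Re(−Σ_n c_n (n·φ)²)`,
`‖e^{−KF(φ)}‖ ≤ e^{−(K/2)Q} · e^{(1−ε₀)(K/2)Q} · e^{−ε₀c₀Kp²}` (S3 `stub_subGaussianMargin` plus the window
Hessian coercivity `cvxr_re_hess_origin_ge` and `ΣΣ(φ_u − φ_u')² ≥ 2·p²`). [folklore] -/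
theorem stub_largeFieldRegulated :
    ∀ (r : ℕ) (B c₀ K p : ℝ) (c : Table r), 0 < B → 0 < c₀ → 0 ≤ K → 0 ≤ p → (∀ n ∈ c.support, ∑ w, n w = 0) → c.sum (fun _ a => a) = 0 → normA c ≤ B → (∀ φ : W r → ℝ, c₀ * ∑ w, ∑ w', (1 - Real.cos (φ w - φ w')) ≤ (genF c φ).re) → ∀ φ : W r → ℝ, (∀ w w' : W r, |φ w - φ w'| ≤ Real.pi) → (∃ w w' : W r, p ≤ |φ w - φ w'|) → ‖Complex.exp (-((K : ℂ) * genF c φ))‖ ≤ Real.exp (-(K / 2) * (-c.sum (fun n a => a * (((∑ w, (n w : ℝ) * φ w) ^ 2 : ℝ) : ℂ))).re) * Real.exp ((1 - 2 * c₀ * (r : ℝ) ^ 3 / (Real.pi ^ 2 * B)) * (K / 2) * (-c.sum (fun n a => a * (((∑ w, (n w : ℝ) * φ w) ^ 2 : ℝ) : ℂ))).re) * Real.exp (-(2 * c₀ * (r : ℝ) ^ 3 / (Real.pi ^ 2 * B) * c₀ * K * p ^ 2)) := by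
  intro r B c₀ K p c hB hc₀ hK hp hU1 hN hA hC φ hosc hex
  obtain ⟨w, w', hww⟩ := hex
  -- step 1: the sub-Gaussian margin (landed S3)
  have h1 := stub_subGaussianMargin r B c₀ K c hB hc₀.le hK hU1 hA hC φ hosc
  -- step 2: window Hessian coercivity at the constants (landed) and `ΣΣ ≥ 2p²`
  have h2 := cvxr_re_hess_origin_ge c hc₀ hN hC φ
  have h3 := two_mul_sq_le_sum_sum_sub_sq hp φ hww
  set Q : ℝ := (-c.sum (fun n a => a * (((∑ w, (n w : ℝ) * φ w) ^ 2 : ℝ) : ℂ))).re with hQ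
  set ε : ℝ := 2 * c₀ * (r : ℝ) ^ 3 / (Real.pi ^ 2 * B) with hε
  have h4 : 2 * (c₀ * p ^ 2) ≤ Q := by
    have := mul_le_mul_of_nonneg_left h3 hc₀.le
    linarith
  -- step 3: exponent algebra
  have hε0 : 0 ≤ ε := by rw [hε]; positivity
  have h5 : ε * K * (2 * (c₀ * p ^ 2)) ≤ ε * K * Q :=
    mul_le_mul_of_nonneg_left h4 (mul_nonneg hε0 hK)
  rw [← Real.exp_add, ← Real.exp_add]
  refine h1.trans ?_
  rw [Real.exp_le_exp]
  linarith

end Summit.HubbardSuperconductivity.HubbardSuperconductivity.Theorems.FatGaussian
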